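import Literature.MathematicalPhysics.QuantumFieldTheory.Balaban1983to89.Beta.RemainderHasMajG1kTower
import Literature.MathematicalPhysics.QuantumFieldTheory.Balaban1983to89.Beta.RemainderHasMajDivG1kTower
import Literature.MathematicalPhysics.QuantumFieldTheory.Balaban1983to89.Beta.RemainderOriginTowerDiv

/-!
# T. Bałaban, *The variational problem and background fields …*, Commun. Math. Phys. **102** (1985) 277–309 [Balaban1985Variational] (182) p. 307, (190)
# p. 308, (129) p. 297, with [Balaban1985BackgroundPropagators] Thm 3.3 (3.42) pp. 397–399 (value AND covariant-derivative lines), (3.8) p. 392, (3.126)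
# p. 420, (3.132)–(3.133) p. 422, (3.137) p. 423: **THE DIVERGENCE LINE OF NODE D OF ROW (D4) AT THE ORIGIN ON NE9's TOWER — THE END: `∃ (α⋆, B, δ₀, B_E,
# A′, r₁)` BEFORE THE HEIGHT, EVERY LETTER A TREE THEOREM BY NAME on the cell's MODEL (`hG0` = «Y4d»∘(K64), `hEG0` = «Y6»∘(DGK), `hInv₀` = «Y4a»∘(FCLK))
# — modulo `Δ⁽²⁾`'s displayed local majorant and the two smallnesses in `λ`**

CITATION HEADER (lean-in-tree rule 2026-08-18).  Sources and loci exactly as in «Y5c» `Beta.RemainderOriginTowerClosed` and «Y7» `Beta.RemainderOriginTowerDiv`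
(this lineage, gen 111): [Balaban1985Variational] (B11 = [15]; held `paper:balaban1985-cmp102-variational-background`, journal page = PDF page + 276): (129)
p. 297 (*«(3.133) [5] with the additional inequality for the covariant Laplace operator»*), (131) p. 298, p. 306 after (179), (180) p. 306, (182) p. 307,
(186)–(187) p. 308, (190) p. 308, (45) p. 285, (110) p. 294; [Balaban1985BackgroundPropagators] (B9 = [5]; `paper:balaban1985-cmp99-background-propagators`,
journal page = PDF page + 388): (3.8) p. 392, Thm 3.1 (3.42) p. 397, Thm 3.3 p. 399, (3.15)–(3.16) p. 393, (3.26) p. 395, Thm 3.11 p. 416, (3.126) p. 420,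
(3.132)–(3.133) p. 422, (3.137)–(3.138) p. 423; [Balaban1984PropagatorsII] (B6) (2.51)–(2.52) p. 232, (2.54) p. 233, Lemma 2.1 (2.61) p. 234.  [15] pp. 297,
306–308 and [5] pp. 397–399, 420–423 re-read this generation in the held text layers.

WHY THIS FILE (audit cell `pub-balaban`, BINDER row (D4), OWNER lineage `b2b-balaban-beta-an4`, gen 111).  «Y7» `Beta.RemainderOriginTowerDiv.exists_ineq190_div_origin_tower_sup`
is the divergence line of NODE D on NE9's tower at ONE height with three analytic letters displayed: `hG0`, `hEG0`, `hInv₀`.  All three are tree theorems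
with their constants BEFORE the height: «Y4d» `Beta.RemainderHasMajG1kTower.exists_hasMaj_G1k_tower_sup` ((K64): `∃ (α₁, B, δ)`), «Y6»
`Beta.RemainderHasMajDivG1kTower.exists_hasMaj_divG1k_tower_sup` ((DGK): `∃ (α₁′, B_E, δ′)`), «Y4a» `Beta.RemainderHasMajQG1QInvTowerClosed.exists_hasMaj_Kinv_tower_sup`
((FCLK): `∃ (α₀, r₁, A′)`); the row sum (2.61) is free on the torus of blocks.  THIS FILE composes them: common window `α⋆ = min(α₁, α₁′, α₀)`, common rate
`δ₀ = min(δ, δ′)` (both letters weakened to it, `e^{−δt} ≤ e^{−δ₀t}`).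
* **`exists_ineq190_div_origin_tower`** — `∃ α⋆ B δ₀ B_E A′ r₁` first, then the UNION block of (K64) ∕ (DGK) ∕ (FCLK) + geometry + rates `(ρ σ c)` with
  `σ > 0`, `ρ ≥ 0`, `ρ + 5σ ≤ δ₀∕d`, `ρ + 5σ ≤ r₁∕d`, `c = c₀(1,σ)^d` + «Y7»'s `Δ⁽²⁾`∕constants∕smallness block ⟹ «Y7»'s conclusion: `G′`, `(Q_kG′Q_k†)⁻¹` two-sided
  ∧ `∀ δ″, δ″∕8 ≤ ρ → Ineq190 S^{coarse}_m S^{fine sites}_m (D*_Uᵉ ∘ (H₀ + G̃Δ⁽²⁾H₀)) (A₀ᴱ + B_G̃ᴱθ_Dc) δ″`, `H₀ = (B9Eq326OperatorTower.H1k … hαL hpos)ᵉ↾ℝ`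
  LITERALLY (`Q_k` onto discharged by `QkW_surjective … hαL`).
READING.  With «Y5c» (value line) and this file (divergence line) two of the lines of NODE D's (190) on `Ω_k = T_η` are kernel-checked END TO END on the
cell's MODEL with `∃`-first constants, each modulo `hD2` (NODE O) and the two smallnesses; the remaining lines (slice gradient ∕ Laplacian ∕ Hölder) follow
the same pattern («V81» socket, a «Y6»-type junction of the NE9 row, a «Y7»∕«Y8» pair) as their NE9 rows land.

HONEST SCOPE.  [folklore] composition BY NAME (three `obtain`s, two `min`s, the free row sum); NO estimate of [5] or [15] is proved; constants crude; nothing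
identifies Bałaban's step-`k` objects with tree terms beyond NE9's tower.  Row (D4) class UNCHANGED (instance 0∕1; D4 DISCHARGE NO DATE); NOT B12 Thm 2, NOT
BetaPertH, NOT continuum, NOT Clay.  HONEST DEPENDENCY (cell line): continuum YM on T⁴ ⇐ BetaPertH ∧ nine spine estimates (0/9 proved); BetaPertH ⇐ (D1) ∧
(D4) ∧ CAP+tail; G-an2-4 gates asym, D1 and NE2/3/4.  NEW file importing «Y4d», «Y6», «Y7»; nothing modified; 0 `def`; standard axioms; no `sorry`.
-/

noncomputable section

open scoped BigOperators InnerProductSpace ComplexConjugate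

namespace Literature.MathematicalPhysics.QuantumFieldTheory.Balaban1983to89.Beta.RemainderOriginTowerDivClosed

open B11SectG B11SupSize190
open B4Sect5Torus (TSite tdist tdist_nonneg)
open B4Sect5Proof (latticeConst)
open B5TorusCover (UT)
open B9Thm34Ext (toB6)
open B9Thm37GlueTorus (torusGeom tdist1 torusSum_tdist1_le)
open B9SectCLatticeCarrier (Bond bpos unshift)
open B9Eq311L2Pairing (WL2)
open B9Eq319QprimeTorus (blockCoord)
open B9Eq315QTower (towerP UlevOf)
open B9Eq315QTorus (perCfg cornerSite)
open B9Eq316TowerFlatIsOneStep (siteCast towerP_eq_fineP_pow)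
open B7Prop1Explicit (U1 Wcx boxVec)
open B9Eq310DeltaPrime (plaqHolU)
open B9Eq310HessianOperator (adTransportW)
open B11Eq103H1Complex (SiteL2K BondL2K KinvLatticeK covDivL2K)
open B9Eq326OperatorTower (laplaceAk QkW G1k H1k)
open B9Eq324DeltaPrimeATower (laplacePrimeAk)
open Beta.RemainderHasMajG1kTower (exists_hasMaj_G1k_tower_sup)
open Beta.RemainderHasMajQG1QInvTowerClosed (exists_hasMaj_Kinv_tower_sup)
open Beta.RemainderHasMajDivG1kTower (exists_hasMaj_divG1k_tower_sup)
open Beta.RemainderOriginTowerDiv (exists_ineq190_div_origin_tower_sup)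

/-! ### The free row sum on the torus of blocks (private) -/

section Aux

variable {d : ℕ} {m : Fin d → ℕ} [∀ i, NeZero (m i)]

/-- The row sum (2.61) on the torus of blocks at any rate `σ > 0`: constant `c₀(1, σ)^d`, uniform in the period. [folklore]
[cite: Balaban1984PropagatorsII, Lemma 2.1 (2.61) p.234] -/
private theorem rowSum_blocks (η₀ L₀ M₀ R : ℝ) (H : Prop) {σ : ℝ} (hσ : 0 < σ) :
    RowSum (toB6 (torusGeom m η₀ L₀ M₀) R H) σ (B6.c0 1 σ ^ d) := by
  intro y
  have h := torusSum_tdist1_le (N := m) y (δ₀ := 1) (α := σ) (by rw [mul_one]; exact hσ)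
  show ∑ y' : UT m, Real.exp (-(σ * tdist1 m y y')) ≤ _
  simpa only [mul_one] using h

end Aux

/-! ## THE END of the divergence line: `∃`-first over the tower -/

section Tower

variable {d : ℕ} (hd : 1 ≤ d) (L : ℕ) [NeZero L] (hL : 1 ≤ L) (hL3 : 3 ≤ L)
  {𝔸 : Type*} [NormedRing 𝔸] [NormedAlgebra ℂ 𝔸] [CompleteSpace 𝔸] [NormOneClass 𝔸] [StarRing 𝔸] [NormedStarGroup 𝔸] [StarModule ℂ 𝔸]
  {W : Type} [NormedAddCommGroup W] [InnerProductSpace ℂ W] [FiniteDimensional ℂ W] (φ : W ≃ₗ[ℂ] 𝔸)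
  {Mφ Mφ' : ℝ} (hMφ : 0 ≤ Mφ) (hMφ' : 0 ≤ Mφ') (hφ : ∀ w, ‖φ w‖ ≤ Mφ * ‖w‖) (hφ' : ∀ X, ‖φ.symm X‖ ≤ Mφ' * ‖X‖) (hstar : ∀ X : 𝔸, ‖star X‖ ≤ ‖X‖)
  {a : ℝ} (ha : 0 < a) {a' : ℝ} (ha' : 0 < a') {ϱ : ℝ} (hϱ0 : 0 ≤ ϱ) (hϱ1 : ϱ < 1)
  (τ : 𝔸 →ₗ[ℂ] ℂ) {Cτ : ℝ} (hτ : ∀ X, ‖τ X‖ ≤ Cτ * ‖X‖) (hCτ : 0 ≤ Cτ) {Mτ : ℝ} (hτm : ∀ X Y : 𝔸, ‖τ (X * Y)‖ ≤ Mτ * ‖X‖ * ‖Y‖) (hMτ : 0 ≤ Mτ)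
  {ρw : ℝ} (hρw : 0 ≤ ρw)
  (hτ₁ : ∀ X : 𝔸, τ (star X) = conj (τ X)) (hτ₂ : ∀ X Y : 𝔸, τ (X * Y) = τ (Y * X)) (hφτ : ∀ X Y : 𝔸, ⟪φ.symm X, φ.symm Y⟫_ℂ = τ (star X * Y))
  (AQ : ℝ)

include hd hL hL3 hMφ hMφ' hφ hφ' hstar ha ha' hϱ0 hϱ1 hτ hCτ hτm hMτ hρw hτ₁ hτ₂ hφτ in
/-- **THE DIVERGENCE LINE OF NODE D AT THE ORIGIN ON NE9's TOWER — THE END, `∃ (α⋆, B, δ₀, B_E, A′, r₁)` FIRST.**  «Y7» with `hG0` := «Y4d» ((K64)),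
`hEG0` := «Y6» ((DGK)), `hInv₀` := «Y4a» ((FCLK)) — common window `min`, common rate `δ₀ = min(δ, δ′)` — and the row sum free (`c₀(1,σ)^d`); under the `∀`:
the UNION of the three data blocks (the cell's MODEL letters, positivity `hpos′`∕`hpos` DISPLAYED, `Q_k` onto from `hαL`), the rates, `Δ⁽²⁾`'s block and the
two smallnesses.  CONCLUSION: «Y7»'s, with `H₀ = B9Eq326OperatorTower.H1k` LITERALLY.
[cite: Balaban1985Variational, (182) p.307, (190) p.308, (129)–(131) pp.297–298, p.306 after (179), (180) p.306; Balaban1985BackgroundPropagators, Thm 3.1 (3.42) p.397, Thm 3.3 p.399, (3.8) p.392, (3.126) p.420, (3.132)–(3.133) p.422, (3.137)–(3.138) p.423, Thm 3.11 p.416; Balaban1984PropagatorsII, (2.54) p.233, Lemma 2.1 (2.61) p.234] -/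
theorem exists_ineq190_div_origin_tower :
    ∃ αs B δ BE A' r₁ : ℝ, 0 < αs ∧ 0 ≤ B ∧ 0 < δ ∧ 0 ≤ BE ∧ 0 ≤ A' ∧ 0 < r₁ ∧
      ∀ (n : ℕ) (η : ℝ) (_hηL : η * (L : ℝ) ^ (n + 1) = 1) (c₀ c₁ : ℝ) [Fact (0 < c₀)] [Fact (0 < c₁)]
        (_hw : c₀ * ((L : ℝ) ^ (n + 1)) ^ d = c₁) (_hρ : |η| ^ d / c₀ ≤ ρw) (m : Fin d → ℕ) [∀ i, NeZero (m i)] (_hm : ∀ i, 1 ≤ m i)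
        (U : Bond d (towerP L m (n + 1)) → 𝔸ˣ) (αU : ℕ → ℝ) (_hα0 : ∀ j, 0 ≤ αU j) (hα1 : ∀ j, αU j ≤ 1 / 64)
        (_hαL : ∀ j, 50 * (d + 1) * αU j * (L : ℝ) ^ d ≤ 1 / 2)
        (hU1 : ∀ (j : ℕ) (x : B7Prop1Explicit.Site d) (k : Fin d), perCfg (towerP L m (j + 1)) (UlevOf L m (n + 1) U j) x k ∈ U1 𝔸)
        (hreg : ∀ (j : ℕ) (y : TSite d (towerP L m j)) (k : Fin d) (ρ' : Fin d → Fin L),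
          ‖((Wcx L (perCfg (towerP L m (j + 1)) (UlevOf L m (n + 1) U j)) (cornerSite L y) k (boxVec L ρ') : 𝔸ˣ) : 𝔸) - 1‖ ≤ αU j)
        (εU : ℕ → ℝ) (_hεU : ∀ j, 0 ≤ εU j) (_hUε : ∀ (j : ℕ) (b : Bond d (towerP L m (j + 1))), ‖(UlevOf L m (n + 1) U j b : 𝔸) - 1‖ ≤ εU j)
        (_hLb : ∀ (j : ℕ) (b : Bond d (towerP L m (j + 1))), UlevOf L m (n + 1) U j b ∈ U1 𝔸)
        (α : ℝ) (_hα : 0 ≤ α) (_hαle : α ≤ αs)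
        (hUst : ∀ b, star (U b : 𝔸) = (((U b)⁻¹ : 𝔸ˣ) : 𝔸)) (_hUb : ∀ b, U b ∈ U1 𝔸) (_hUη : ∀ b, ‖(U b : 𝔸) - 1‖ ≤ α * η)
        (_hpl : ∀ p : B9SectCLatticeCarrier.Plaq d (towerP L m (n + 1)), ‖(plaqHolU U p : 𝔸) - 1‖ ≤ α * η ^ 2)
        (_hUgrad : ∀ (x : TSite d (towerP L m (n + 1))) (μ : Fin d), ‖(U (x, μ) : 𝔸) - U (unshift μ x, μ)‖ ≤ α * η ^ 2)
        (_hRlev : ∀ (j : ℕ) (b : Bond d (towerP L m (j + 1))) (w : W), ‖adTransportW φ (UlevOf L m (n + 1) U j) b w‖ ≤ ‖w‖)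
        (_hεg : ∀ j < n + 1, εU j ≤ α * ϱ ^ j) (_hAQ : ∑ j ∈ Finset.range (n + 1), αU j ≤ AQ)
        (hpos' : ∀ x : SiteL2K ℂ d (towerP L m (n + 1)) c₀ W, x ≠ 0 → 0 < RCLike.re ⟪x, laplacePrimeAk L m n φ η U a' (c₁ := c₁) x⟫_ℂ)
        (hpos : ∀ x : BondL2K ℂ d (towerP L m (n + 1)) c₀ W, x ≠ 0 →
          0 < RCLike.re ⟪x, laplaceAk L m n φ η U hL αU hα1 hU1 hreg τ (c₀ := c₀) (c₁ := c₁) a x⟫_ℂ)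
        (η₀ L₀ M₀ R : ℝ) (H : Prop)
        -- the rates and the (free) row-sum constant
        (ρ σ c : ℝ) (_hσ : 0 < σ) (_hρ0 : 0 ≤ ρ) (_hρ₁ : ρ + 5 * σ ≤ δ / d) (_hρI : ρ + 5 * σ ≤ r₁ / d) (_hc_def : c = B6.c0 1 σ ^ d)
    -- `Δ⁽²⁾` DISPLAYED: a local operator on the fine carrier ((3.137): range `r_D`, row and column sums `≤ λ`)
    (D2 : BondL2K ℂ d (towerP L m (n + 1)) c₀ W →ₗ[ℂ] BondL2K ℂ d (towerP L m (n + 1)) c₀ W)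
    {KD : UT m → UT m → ℝ} {lam rD : ℝ} (hlam : 0 ≤ lam) (hKD : ∀ y v, 0 ≤ KD y v)
    (hDloc : ∀ y v, KD y v ≠ 0 → (toB6 (torusGeom m η₀ L₀ M₀) R H).dist y v ≤ rD)
    (hDrow : ∀ y, ∑ v : UT m, KD y v ≤ lam) (hDcol : ∀ v, ∑ y : UT m, KD y v ≤ lam)
    (hD2 : HasMaj
      (supSize (toB6 (torusGeom m η₀ L₀ M₀) R H)
        (fun y => Finset.univ.filter fun b : Bond d (towerP L m (n + 1)) =>
          blockCoord (L ^ (n + 1)) m (siteCast (towerP_eq_fineP_pow L m (n + 1)) (bpos b)) = UT.toSite m y)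
        (fun b => UT.ofSite m (blockCoord (L ^ (n + 1)) m (siteCast (towerP_eq_fineP_pow L m (n + 1)) (bpos b)))) :
          BlockNorm (toB6 (torusGeom m η₀ L₀ M₀) R H) (Bond d (towerP L m (n + 1)) → W))
      (supSize (toB6 (torusGeom m η₀ L₀ M₀) R H)
        (fun y => Finset.univ.filter fun b : Bond d (towerP L m (n + 1)) =>
          blockCoord (L ^ (n + 1)) m (siteCast (towerP_eq_fineP_pow L m (n + 1)) (bpos b)) = UT.toSite m y)
        (fun b => UT.ofSite m (blockCoord (L ^ (n + 1)) m (siteCast (towerP_eq_fineP_pow L m (n + 1)) (bpos b)))))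
      (((WL2.linearEquiv ℂ ℂ (fun _ : Bond d (towerP L m (n + 1)) => c₀) :
            BondL2K ℂ d (towerP L m (n + 1)) c₀ W ≃ₗ[ℂ] (Bond d (towerP L m (n + 1)) → W)).toLinearMap ∘ₗ D2 ∘ₗ
          (WL2.linearEquiv ℂ ℂ (fun _ : Bond d (towerP L m (n + 1)) => c₀) :
            BondL2K ℂ d (towerP L m (n + 1)) c₀ W ≃ₗ[ℂ] (Bond d (towerP L m (n + 1)) → W)).symm.toLinearMap).restrictScalars ℝ)
      KD)
    -- the derived constants, bound to their closed forms (instantiate with `rfl`), and the TWO smallnesses in `λ`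
    {q BG' θP qI BI' A₀ θD A₀E BEG' BEt : ℝ}
    (hq_def : q = B * lam * Real.exp (δ / d * rD) * c) (hq : q < 1) (hBG' : BG' = B * (1 - q)⁻¹)
    (hθP : θP = B * lam * Real.exp (δ / d * rD) * BG' * c *
      ((Mφ' * Real.exp (100 * d * (d + 1) * (L : ℝ) ^ d * AQ) * Mφ * ((2 * d : ℕ) : ℝ)) * Real.exp 1 * latticeConst d 1) *
      Real.exp ((ρ + 4 * σ) * d) * ((Mφ' * Mφ * Real.exp (50 * (d + 1) * AQ)) * Real.exp 1 * latticeConst d 1) *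
      Real.exp ((ρ + 4 * σ) * d))
    (hqI : qI = A' * θP * c * c) (hqI1 : qI < 1) (hBI' : BI' = A' * (1 - qI)⁻¹)
    (hA₀ : A₀ = B * ((Mφ' * Real.exp (100 * d * (d + 1) * (L : ℝ) ^ d * AQ) * Mφ * ((2 * d : ℕ) : ℝ)) * Real.exp 1 *
      latticeConst d 1) * Real.exp δ * A' * c)
    (hθD : θD = A₀ * lam * Real.exp (ρ * rD))
    (hA₀E : A₀E = BE * ((Mφ' * Real.exp (100 * d * (d + 1) * (L : ℝ) ^ d * AQ) * Mφ * ((2 * d : ℕ) : ℝ)) * Real.exp 1 * latticeConst d 1) * Real.exp δ * A' * c)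
    (hBEG' : BEG' = BE + BE * lam * Real.exp (δ / d * rD) * BG' * c)
    (hBEt : BEt = BEG' + ((Mφ' * Mφ * Real.exp (50 * (d + 1) * AQ)) * Real.exp 1 * latticeConst d 1) *
      ((Mφ' * Real.exp (100 * d * (d + 1) * (L : ℝ) ^ d * AQ) * Mφ * ((2 * d : ℕ) : ℝ)) * Real.exp 1 * latticeConst d 1) *
      BI' * BEG' * BG' * Real.exp ((ρ + 2 * σ) * d) * Real.exp ((ρ + 2 * σ) * d) * c * c),
    ∃ (G' : (Bond d (towerP L m (n + 1)) → W) →L[ℂ] (Bond d (towerP L m (n + 1)) → W))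
      (Inv' : (Bond d m → W) →L[ℂ] (Bond d m → W)),
      -- `G′ = (Δ_{a,k}(U) − Δ⁽²⁾)⁻¹`, two-sided
      G' * (LinearMap.toContinuousLinearMap
          ((WL2.linearEquiv ℂ ℂ (fun _ : Bond d (towerP L m (n + 1)) => c₀) :
              BondL2K ℂ d (towerP L m (n + 1)) c₀ W ≃ₗ[ℂ] (Bond d (towerP L m (n + 1)) → W)).toLinearMap ∘ₗ
            laplaceAk L m n φ η U hL αU hα1 hU1 hreg τ (c₀ := c₀) (c₁ := c₁) a ∘ₗ
            (WL2.linearEquiv ℂ ℂ (fun _ : Bond d (towerP L m (n + 1)) => c₀) :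
              BondL2K ℂ d (towerP L m (n + 1)) c₀ W ≃ₗ[ℂ] (Bond d (towerP L m (n + 1)) → W)).symm.toLinearMap) -
        LinearMap.toContinuousLinearMap
          ((WL2.linearEquiv ℂ ℂ (fun _ : Bond d (towerP L m (n + 1)) => c₀) :
              BondL2K ℂ d (towerP L m (n + 1)) c₀ W ≃ₗ[ℂ] (Bond d (towerP L m (n + 1)) → W)).toLinearMap ∘ₗ D2 ∘ₗ
            (WL2.linearEquiv ℂ ℂ (fun _ : Bond d (towerP L m (n + 1)) => c₀) :
              BondL2K ℂ d (towerP L m (n + 1)) c₀ W ≃ₗ[ℂ] (Bond d (towerP L m (n + 1)) → W)).symm.toLinearMap)) = 1 ∧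
      (LinearMap.toContinuousLinearMap
          ((WL2.linearEquiv ℂ ℂ (fun _ : Bond d (towerP L m (n + 1)) => c₀) :
              BondL2K ℂ d (towerP L m (n + 1)) c₀ W ≃ₗ[ℂ] (Bond d (towerP L m (n + 1)) → W)).toLinearMap ∘ₗ
            laplaceAk L m n φ η U hL αU hα1 hU1 hreg τ (c₀ := c₀) (c₁ := c₁) a ∘ₗ
            (WL2.linearEquiv ℂ ℂ (fun _ : Bond d (towerP L m (n + 1)) => c₀) :
              BondL2K ℂ d (towerP L m (n + 1)) c₀ W ≃ₗ[ℂ] (Bond d (towerP L m (n + 1)) → W)).symm.toLinearMap) -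
        LinearMap.toContinuousLinearMap
          ((WL2.linearEquiv ℂ ℂ (fun _ : Bond d (towerP L m (n + 1)) => c₀) :
              BondL2K ℂ d (towerP L m (n + 1)) c₀ W ≃ₗ[ℂ] (Bond d (towerP L m (n + 1)) → W)).toLinearMap ∘ₗ D2 ∘ₗ
            (WL2.linearEquiv ℂ ℂ (fun _ : Bond d (towerP L m (n + 1)) => c₀) :
              BondL2K ℂ d (towerP L m (n + 1)) c₀ W ≃ₗ[ℂ] (Bond d (towerP L m (n + 1)) → W)).symm.toLinearMap)) * G' = 1 ∧
      -- `Inv′ = (Q_kG′Q_k†)⁻¹`, two-sided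
      Inv' * ((LinearMap.toContinuousLinearMap
          ((WL2.linearEquiv ℂ ℂ (fun _ : Bond d m => c₁) : BondL2K ℂ d m c₁ W ≃ₗ[ℂ] (Bond d m → W)).toLinearMap ∘ₗ
            QkW L m n φ U hL αU hα1 hU1 hreg (c₀ := c₀) (c₁ := c₁) ∘ₗ
            (WL2.linearEquiv ℂ ℂ (fun _ : Bond d (towerP L m (n + 1)) => c₀) :
              BondL2K ℂ d (towerP L m (n + 1)) c₀ W ≃ₗ[ℂ] (Bond d (towerP L m (n + 1)) → W)).symm.toLinearMap)).comp
        (G'.comp (LinearMap.toContinuousLinearMap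
          ((WL2.linearEquiv ℂ ℂ (fun _ : Bond d (towerP L m (n + 1)) => c₀) :
              BondL2K ℂ d (towerP L m (n + 1)) c₀ W ≃ₗ[ℂ] (Bond d (towerP L m (n + 1)) → W)).toLinearMap ∘ₗ
            LinearMap.adjoint (QkW L m n φ U hL αU hα1 hU1 hreg (c₀ := c₀) (c₁ := c₁)) ∘ₗ
            (WL2.linearEquiv ℂ ℂ (fun _ : Bond d m => c₁) : BondL2K ℂ d m c₁ W ≃ₗ[ℂ] (Bond d m → W)).symm.toLinearMap)))) = 1 ∧
      ((LinearMap.toContinuousLinearMap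
          ((WL2.linearEquiv ℂ ℂ (fun _ : Bond d m => c₁) : BondL2K ℂ d m c₁ W ≃ₗ[ℂ] (Bond d m → W)).toLinearMap ∘ₗ
            QkW L m n φ U hL αU hα1 hU1 hreg (c₀ := c₀) (c₁ := c₁) ∘ₗ
            (WL2.linearEquiv ℂ ℂ (fun _ : Bond d (towerP L m (n + 1)) => c₀) :
              BondL2K ℂ d (towerP L m (n + 1)) c₀ W ≃ₗ[ℂ] (Bond d (towerP L m (n + 1)) → W)).symm.toLinearMap)).comp
        (G'.comp (LinearMap.toContinuousLinearMap
          ((WL2.linearEquiv ℂ ℂ (fun _ : Bond d (towerP L m (n + 1)) => c₀) :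
              BondL2K ℂ d (towerP L m (n + 1)) c₀ W ≃ₗ[ℂ] (Bond d (towerP L m (n + 1)) → W)).toLinearMap ∘ₗ
            LinearMap.adjoint (QkW L m n φ U hL αU hα1 hU1 hreg (c₀ := c₀) (c₁ := c₁)) ∘ₗ
            (WL2.linearEquiv ℂ ℂ (fun _ : Bond d m => c₁) : BondL2K ℂ d m c₁ W ≃ₗ[ℂ] (Bond d m → W)).symm.toLinearMap)))) * Inv' = 1 ∧
      -- the (190) letter of `H₀ + G̃Δ⁽²⁾H₀`, `H₀ = H₁,k(U)` by name, `G̃ = G′ − G′Q_k†·Inv′·Q_kG′`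
      ∀ δ' : ℝ, δ' / 8 ≤ ρ →
        Ineq190
          (supSize (toB6 (torusGeom m η₀ L₀ M₀) R H)
            (fun y => Finset.univ.filter fun c : Bond d m => bpos c = UT.toSite m y)
            (fun c => UT.ofSite m (bpos c)) : BlockNorm (toB6 (torusGeom m η₀ L₀ M₀) R H) (Bond d m → W))
          (supSize (toB6 (torusGeom m η₀ L₀ M₀) R H)
            (fun y => Finset.univ.filter fun x : TSite d (towerP L m (n + 1)) =>
              blockCoord (L ^ (n + 1)) m (siteCast (towerP_eq_fineP_pow L m (n + 1)) x) = UT.toSite m y)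
            (fun x => UT.ofSite m (blockCoord (L ^ (n + 1)) m (siteCast (towerP_eq_fineP_pow L m (n + 1)) x))) :
              BlockNorm (toB6 (torusGeom m η₀ L₀ M₀) R H) (TSite d (towerP L m (n + 1)) → W))
          ((((WL2.linearEquiv ℂ ℂ (fun _ : TSite d (towerP L m (n + 1)) => c₀) :
                SiteL2K ℂ d (towerP L m (n + 1)) c₀ W ≃ₗ[ℂ] (TSite d (towerP L m (n + 1)) → W)).toLinearMap ∘ₗ
              covDivL2K ℂ c₀ ((η : ℂ))⁻¹ (adTransportW φ fun bb => (U bb)⁻¹) ∘ₗ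
              (WL2.linearEquiv ℂ ℂ (fun _ : Bond d (towerP L m (n + 1)) => c₀) :
                BondL2K ℂ d (towerP L m (n + 1)) c₀ W ≃ₗ[ℂ] (Bond d (towerP L m (n + 1)) → W)).symm.toLinearMap).restrictScalars ℝ) ∘ₗ
          ((((WL2.linearEquiv ℂ ℂ (fun _ : Bond d (towerP L m (n + 1)) => c₀) :
                  BondL2K ℂ d (towerP L m (n + 1)) c₀ W ≃ₗ[ℂ] (Bond d (towerP L m (n + 1)) → W)).toLinearMap ∘ₗ
              H1k L m n φ η U hL αU hα1 hU1 hreg τ (c₀ := c₀) (c₁ := c₁) _hαL hpos ∘ₗ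
              (WL2.linearEquiv ℂ ℂ (fun _ : Bond d m => c₁) : BondL2K ℂ d m c₁ W ≃ₗ[ℂ] (Bond d m → W)).symm.toLinearMap).restrictScalars ℝ) +
            ((G'.restrictScalars ℝ : (Bond d (towerP L m (n + 1)) → W) →ₗ[ℝ] (Bond d (towerP L m (n + 1)) → W)) -
              ((G'.restrictScalars ℝ : (Bond d (towerP L m (n + 1)) → W) →ₗ[ℝ] (Bond d (towerP L m (n + 1)) → W)) ∘ₗ
                (((WL2.linearEquiv ℂ ℂ (fun _ : Bond d (towerP L m (n + 1)) => c₀) :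
                      BondL2K ℂ d (towerP L m (n + 1)) c₀ W ≃ₗ[ℂ] (Bond d (towerP L m (n + 1)) → W)).toLinearMap ∘ₗ
                  LinearMap.adjoint (QkW L m n φ U hL αU hα1 hU1 hreg (c₀ := c₀) (c₁ := c₁)) ∘ₗ
                  (WL2.linearEquiv ℂ ℂ (fun _ : Bond d m => c₁) : BondL2K ℂ d m c₁ W ≃ₗ[ℂ] (Bond d m → W)).symm.toLinearMap).restrictScalars ℝ)) ∘ₗ
              (Inv'.restrictScalars ℝ : (Bond d m → W) →ₗ[ℝ] (Bond d m → W)) ∘ₗ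
              ((((WL2.linearEquiv ℂ ℂ (fun _ : Bond d m => c₁) : BondL2K ℂ d m c₁ W ≃ₗ[ℂ] (Bond d m → W)).toLinearMap ∘ₗ
                  QkW L m n φ U hL αU hα1 hU1 hreg (c₀ := c₀) (c₁ := c₁) ∘ₗ
                  (WL2.linearEquiv ℂ ℂ (fun _ : Bond d (towerP L m (n + 1)) => c₀) :
                    BondL2K ℂ d (towerP L m (n + 1)) c₀ W ≃ₗ[ℂ] (Bond d (towerP L m (n + 1)) → W)).symm.toLinearMap).restrictScalars ℝ) ∘ₗ
                (G'.restrictScalars ℝ : (Bond d (towerP L m (n + 1)) → W) →ₗ[ℝ] (Bond d (towerP L m (n + 1)) → W)))) ∘ₗ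
            ((((WL2.linearEquiv ℂ ℂ (fun _ : Bond d (towerP L m (n + 1)) => c₀) :
                    BondL2K ℂ d (towerP L m (n + 1)) c₀ W ≃ₗ[ℂ] (Bond d (towerP L m (n + 1)) → W)).toLinearMap ∘ₗ D2 ∘ₗ
                (WL2.linearEquiv ℂ ℂ (fun _ : Bond d (towerP L m (n + 1)) => c₀) :
                  BondL2K ℂ d (towerP L m (n + 1)) c₀ W ≃ₗ[ℂ] (Bond d (towerP L m (n + 1)) → W)).symm.toLinearMap).restrictScalars ℝ) ∘ₗ
              (((WL2.linearEquiv ℂ ℂ (fun _ : Bond d (towerP L m (n + 1)) => c₀) :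
                    BondL2K ℂ d (towerP L m (n + 1)) c₀ W ≃ₗ[ℂ] (Bond d (towerP L m (n + 1)) → W)).toLinearMap ∘ₗ
                H1k L m n φ η U hL αU hα1 hU1 hreg τ (c₀ := c₀) (c₁ := c₁) _hαL hpos ∘ₗ
                (WL2.linearEquiv ℂ ℂ (fun _ : Bond d m => c₁) : BondL2K ℂ d m c₁ W ≃ₗ[ℂ] (Bond d m → W)).symm.toLinearMap).restrictScalars ℝ))))
          (A₀E + BEt * θD * c) δ' := by
  obtain ⟨α₁, B, δ₁, hα₁, hB, hδ₁, HG⟩ := exists_hasMaj_G1k_tower_sup hd L hL hL3 φ hMφ hMφ' hφ hφ' hstar ha ha' hϱ0 hϱ1 τ hτ hCτ hτm hMτ hρw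
    hτ₁ hτ₂ hφτ AQ
  obtain ⟨α₂, BE, δ₂, hα₂, hBE, hδ₂, HE⟩ := exists_hasMaj_divG1k_tower_sup hd L hL hL3 φ hMφ hMφ' hφ hφ' hstar ha ha' hϱ0 hϱ1 τ hτ hCτ hτm hMτ
    hρw hτ₁ hτ₂ hφτ AQ
  obtain ⟨α₀, r₁, A', hα₀, hr₁, hA', HI⟩ := exists_hasMaj_Kinv_tower_sup hd L hL hL3 φ hMφ hMφ' hφ hφ' hstar ha ha' hϱ0 hϱ1 τ hτ hCτ hτm hMτ hρw
    hτ₁ hτ₂ hφτ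
  refine ⟨min (min α₁ α₂) α₀, B, min δ₁ δ₂, BE, A', r₁, lt_min (lt_min hα₁ hα₂) hα₀, hB, lt_min hδ₁ hδ₂, hBE, hA', hr₁, ?_⟩
  intro n η hηL c₀ c₁ _ _ hw hρ m _ hm U αU hα0 hα1 hαL hU1 hreg εU hεU hUε hLb α hα hαle hUst hUb hUη hpl hUgrad hRlev hεg hAQ hpos' hpos
    η₀ L₀ M₀ R H ρ σ c hσ hρ0 hρ₁ hρI hc_def D2 KD lam rD hlam hKD hDloc hDrow hDcol hD2 q BG' θP qI BI' A₀ θD A₀E BEG' BEt hq_def hq hBG' hθP hqI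
    hqI1 hBI' hA₀ hθD hA₀E hBEG' hBEt
  have hα₁' : α ≤ α₁ := hαle.trans ((min_le_left _ _).trans (min_le_left _ _))
  have hα₂' : α ≤ α₂ := hαle.trans ((min_le_left _ _).trans (min_le_right _ _))
  have hα₀' : α ≤ α₀ := hαle.trans (min_le_right _ _)
  -- the three analytic letters at this height, BY NAME, the first two weakened to the common rate
  have hG0 := (HG n η hηL c₀ c₁ hw hρ m hm U αU hα0 hα1 hU1 hreg εU hεU hUε hLb α hα hα₁' hUst hUb hUη hpl hUgrad hRlev hεg hAQ hpos' hpos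
    η₀ L₀ M₀ R H).mono fun y v => mul_le_mul_of_nonneg_left
      (Real.exp_le_exp.mpr (neg_le_neg (mul_le_mul_of_nonneg_right (min_le_left δ₁ δ₂) (tdist_nonneg _ _ _)))) hB
  have hEG0 := (HE n η hηL c₀ c₁ hw hρ m hm U αU hα0 hα1 hU1 hreg εU hεU hUε hLb α hα hα₂' hUst hUb hUη hpl hUgrad hRlev hεg hAQ hpos' hpos
    η₀ L₀ M₀ R H).mono fun y v => mul_le_mul_of_nonneg_left
      (Real.exp_le_exp.mpr (neg_le_neg (mul_le_mul_of_nonneg_right (min_le_right δ₁ δ₂) (tdist_nonneg _ _ _)))) hBE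
  have hQ := B9Eq326OperatorTower.QkW_surjective L m n φ U hL αU hα1 hU1 hreg (c₀ := c₀) (c₁ := c₁) hαL
  have hInv0 := HI n η hηL c₀ c₁ hw hρ m hm U αU hα0 hα1 hαL hU1 hreg εU hεU hUε hLb α hα hα₀' hUst hUb hUη hpl
    hεg hpos hQ η₀ L₀ M₀ R H
  -- the free row sum
  have hrow : RowSum (toB6 (torusGeom m η₀ L₀ M₀) R H) σ c := by rw [hc_def]; exact rowSum_blocks η₀ L₀ M₀ R H hσ
  have hc : 0 ≤ c := by
    rw [hc_def]
    refine pow_nonneg ?_ _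
    unfold B6.c0
    exact tsum_nonneg fun z => (Real.exp_pos _).le
  exact exists_ineq190_div_origin_tower_sup L m n φ η U hL αU hα0 hα1 hU1 hreg hMφ hφ hMφ' hφ' τ hpos hQ η₀ L₀ M₀ R H hd hm hw hAQ hB
    (lt_min hδ₁ hδ₂).le hA' hr₁.le hBE hrow hc hσ.le hρ0 hρ₁ hρI hG0 hEG0 hInv0 D2 hlam hKD hDloc hDrow hDcol hD2 hq_def hq hBG' hθP hqI
    hqI1 hBI' hA₀ hθD hA₀E hBEG' hBEt

end Tower

end Literature.MathematicalPhysics.QuantumFieldTheory.Balaban1983to89.Beta.RemainderOriginTowerDivClosed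

end
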